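import Summits.Langlands.Langlands.Theorems.NonParallelVoidTensorSquareParallelStubTensorInductionPDConstruction
import Literature.NumberTheory.GaloisRepresentations.ImaginaryQuadraticCyclotomicProofs
import HarnessLib

/-!
# Tensor induction along an index-two subgroup, III: the symmetric form `J = J₂ ⊗ J₂`, the
# multiplier `μ`, complex conjugation, and the conjuncts (T0), (T1), (T2), (T5) over `ℚ`

Helper file 3/3 of stub `stub_tensorInductionPD` (crux `NonParallelVoid.TensorSquareParallel`,
stmt-Langlands-17009, line `merged`); registered sub-goal `stub_tensorInductionPD_exists`.

For a rank-two `ρ : Γ_F →ₜ* GL₂(A)` the tensor induction `Ψ = ⊗-Ind_{Γ_F}^{Γ_K} ρ` (file 2,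
`tensorInduce`) preserves the symmetric form `J₄ = J₂ ⊗ₖ J₂` (`J₂ = (0 1; -1 0)`, file 1) up to the
**multiplier** `μ = tiMult : Γ_K →* A`, itself the index-two extension of `σ ↦ det ρ(σ) det ρ(θ σ)`
by `τ ↦ det ρ(t)` (`tiMatrixHom_transpose_mul_J₄_mul`, `tensorInduce_transpose_mul_tiForm_mul`:
`Ψ(g)ᵀ J Ψ(g) = μ(g) J`, i.e. `Ψ : Γ_K → GO(J) ≅ GO₄`); `J` is symmetric with `det J = 1`
(`tiForm_isSymm`, `isUnit_det_tiForm`).  On an involution `g ∈ Γ_K ∖ res(Γ_F)`, `μ(g) = 1`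
(`tiMult_of_not_mem_of_mul_self`) and `tr Ψ(g) = n` (file 2).  For `K = ℚ` and `F` imaginary
quadratic a complex conjugation `c` is such an involution
(`Rat.not_mem_range_absGaloisRestrict_of_isComplexConjugation`, `IsComplexConjugation.sq_eq_one`),
whence **`exists_tensorInduction`**: the conjuncts (T0) (trace on `Γ_F`), (T1) (unramified a.e.),
(T2) (`GO₄`-valued with `μ(c) = 1`) and (T5) (`tr Ψ(c) = 2 ≠ 0`) of stub `stub_tensorInductionPD`
for `ψ = ⊗-Ind ρ : Γ_ℚ →ₜ* GL₄(ℚ̄_p)`.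

NOT here (and not derivable in the tree today): the `p`-adic Hodge conjunct (T3) of the stub —
crystallinity, labelled Hodge–Tate weights `{a+a', a+b', b+a', b+b'}` and potential diagonalizability
of `ψ|_{Γ_{ℚ_p}} ≅ ρ|_{Γ_{F_v}} ⊗ ρ|_{Γ_{F_w}}` for THE pinned datum `fontainePstAdicCompletion`: no clause
among (F1)–(F12) of `IsFontaineDatum` relates `IsCrystallineFramed` / `labelledHodgeTateWeightsAt` /
`IsPotentiallyDiagonalizable` of a Kronecker product (or of a restriction along an isomorphism of
completions) to those of its factors (cf. the hypotheses `hcr`, `hHT` of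
`isCrystallineFramed_and_labelledHodgeTateWeightsAt_restrictField` in `ToLocalRestrictField`, the named
facts `CrystallineBaseChange`, `LabelledHodgeTateWeightsBaseChange`, and the `⊗`-clause TODO of
`PotentialDiagonalizabilityFontaineLaffaille`).

References: F. Calegari, *Even Galois representations and the Fontaine–Mazur conjecture*, Invent.
Math. 185 (2011), §2 (`⊗-Ind` lands in `GO₄`; the sign at complex conjugation); T. Barnet-Lamb,
T. Gee, D. Geraghty, R. Taylor, *Potential automorphy and change of weight*, §2.1 (`GO_n`,
multipliers); C. W. Curtis, I. Reiner, *Methods of Representation Theory* I, §13.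
-/

noncomputable section

set_option linter.dupNamespace false  -- `Summit.Langlands.Langlands.…` is the mandated summit-side namespace (D-0022)

open Matrix Topology Field
open scoped Kronecker

namespace Summit.Langlands.Langlands.Theorems.TensorSquareParallel

open Literature.NumberTheory.GaloisRepresentations

/-! ### The symmetric form and the multiplier (rank two: `⊗-Ind ρ` lands in `GO₄`) -/

section Form

universe u v

variable (K : Type u) (F : Type v) [Field K] [Field F] [Algebra K F] [CharZero K]
  [FiniteDimensional K F] [IsGalois K F] [CharZero F]
  {A : Type*} [CommRing A] [TopologicalSpace A] [IsTopologicalRing A] {n m : ℕ}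

omit [IsGalois K F] [CharZero F] [IsTopologicalRing A] in
/-- `det ρ(a b a⁻¹) = det ρ(b)`. [folklore] -/
theorem det_toMatrixHom_conj (ρ : FramedGaloisRep F A n) (a b : absoluteGaloisGroup F) :
    (FramedRep.toMatrixHom ρ (a * b * a⁻¹)).det = (FramedRep.toMatrixHom ρ b).det := by
  rw [map_mul, map_mul, Matrix.det_mul, Matrix.det_mul, mul_right_comm, ← Matrix.det_mul, ← map_mul,
    mul_inv_cancel, map_one, Matrix.det_one, one_mul]

omit [IsTopologicalRing A] in
/-- `det ρ(θ(θ σ)) = det ρ(σ)` (`θ² ` is inner). [folklore] -/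
theorem det_toMatrixHom_tiTheta_tiTheta (h2 : Module.finrank K F = 2) (ρ : FramedGaloisRep F A n)
    (σ : absoluteGaloisGroup F) :
    (FramedRep.toMatrixHom ρ (tiTheta K F h2 (tiTheta K F h2 σ))).det = (FramedRep.toMatrixHom ρ σ).det := by
  rw [tiTheta_tiTheta_apply, det_toMatrixHom_conj]

/-- `σ ↦ det ρ(σ) · det ρ(θ σ)`, the multiplier on `Γ_F`. [folklore] -/
def tiDetPair (h2 : Module.finrank K F = 2) (ρ : FramedGaloisRep F A n) : absoluteGaloisGroup F →* A :=
  (Matrix.detMonoidHom.comp (FramedRep.toMatrixHom ρ)) *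
    (Matrix.detMonoidHom.comp ((FramedRep.toMatrixHom ρ).comp (tiTheta K F h2).toMonoidHom))

omit [IsTopologicalRing A] in
/-- Unfolding lemma for `tiDetPair`. [folklore] -/
@[simp] theorem tiDetPair_apply (h2 : Module.finrank K F = 2) (ρ : FramedGaloisRep F A n)
    (σ : absoluteGaloisGroup F) :
    tiDetPair K F h2 ρ σ =
      (FramedRep.toMatrixHom ρ σ).det * (FramedRep.toMatrixHom ρ (tiTheta K F h2 σ)).det := rfl

/-- **The multiplier `μ : Γ_K →* A` of `⊗-Ind ρ`**: the index-two extension of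
`σ ↦ det ρ(σ) det ρ(θ σ)` by `τ ↦ det ρ(t)` (for rank two, `(⊗-Ind ρ)(g)ᵀ J (⊗-Ind ρ)(g) = μ(g) J`).
Ref: Calegari 2011, §2. [folklore] -/
def tiMult (h2 : Module.finrank K F = 2) (ρ : FramedGaloisRep F A n) : absoluteGaloisGroup K →* A :=
  indexTwoExtendHom (φ := (absGaloisRestrict K F).toMonoidHom) (absGaloisRestrict_injective K F)
    (tiDetPair K F h2 ρ) (tiTau_not_mem K F h2) ((FramedRep.toMatrixHom ρ (tiSq K F h2)).det)
    (θ := (tiTheta K F h2).toMonoidHom) (fun σ => absGaloisRestrict_absGaloisOuterConj K F _ σ)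
    (t := tiSq K F h2) (absGaloisRestrict_tiSq K F h2)
    (fun σ => by
      change _ * tiDetPair K F h2 ρ σ = tiDetPair K F h2 ρ (tiTheta K F h2 σ) * _
      rw [tiDetPair_apply, tiDetPair_apply, det_toMatrixHom_tiTheta_tiTheta]
      ring)
    (by rw [tiDetPair_apply, tiTheta_tiSq])
    (fun _ hg => mul_tiTau_inv_mem K F h2 hg)

omit [IsTopologicalRing A] in
/-- `μ(res σ) = det ρ(σ) det ρ(θ σ)`. [folklore] -/
theorem tiMult_absGaloisRestrict (h2 : Module.finrank K F = 2) (ρ : FramedGaloisRep F A n)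
    (σ : absoluteGaloisGroup F) :
    tiMult K F h2 ρ (absGaloisRestrict K F σ) =
      (FramedRep.toMatrixHom ρ σ).det * (FramedRep.toMatrixHom ρ (tiTheta K F h2 σ)).det :=
  indexTwoExtend_apply_map (absGaloisRestrict_injective K F) _ (tiTau_not_mem K F h2) _ σ

omit [IsTopologicalRing A] in
/-- `μ(res(σ) τ) = det ρ(σ) det ρ(θ σ) det ρ(t)`. [folklore] -/
theorem tiMult_absGaloisRestrict_mul_tiTau (h2 : Module.finrank K F = 2) (ρ : FramedGaloisRep F A n)
    (σ : absoluteGaloisGroup F) :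
    tiMult K F h2 ρ (absGaloisRestrict K F σ * tiTau K F h2) =
      (FramedRep.toMatrixHom ρ σ).det * (FramedRep.toMatrixHom ρ (tiTheta K F h2 σ)).det *
        (FramedRep.toMatrixHom ρ (tiSq K F h2)).det :=
  indexTwoExtend_apply_map_mul (absGaloisRestrict_injective K F) _ (tiTau_not_mem K F h2) _ σ

omit [IsTopologicalRing A] in
/-- **`μ(g) = 1` for an involution `g ∈ Γ_K ∖ res(Γ_F)`** (e.g. a complex conjugation, `F` totally
complex): `μ(res(σ) τ) = det ρ(σ θ(σ) t) = det ρ(1)`. Ref: Calegari 2011, §2. [folklore] -/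
theorem tiMult_of_not_mem_of_mul_self (h2 : Module.finrank K F = 2) (ρ : FramedGaloisRep F A n)
    {g : absoluteGaloisGroup K} (hg : g ∉ (absGaloisRestrict K F).range) (hgg : g * g = 1) :
    tiMult K F h2 ρ g = 1 := by
  obtain ⟨σ, hσ⟩ := mul_tiTau_inv_mem K F h2 hg
  have hgeq : g = absGaloisRestrict K F σ * tiTau K F h2 := by
    rw [show absGaloisRestrict K F σ = g * (tiTau K F h2)⁻¹ from hσ, inv_mul_cancel_right]
  rw [hgeq] at hgg ⊢
  rw [tiMult_absGaloisRestrict_mul_tiTau, mul_assoc, ← Matrix.det_mul, ← Matrix.det_mul, ← map_mul,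
    ← map_mul, mul_tiTheta_mul_tiSq_eq_one K F h2 hgg, map_one, Matrix.det_one]

omit [IsTopologicalRing A] in
/-- **`Ψ(g)ᵀ J₄ Ψ(g) = μ(g) J₄`**: the tensor induction of a rank-two representation preserves the
symmetric form `J₄ = J₂ ⊗ J₂` up to the multiplier `μ`. Ref: Calegari 2011, §2. [folklore] -/
theorem tiMatrixHom_transpose_mul_J₄_mul (h2 : Module.finrank K F = 2) (ρ : FramedGaloisRep F A 2)
    (g : absoluteGaloisGroup K) :
    (tiMatrixHom K F h2 ρ g)ᵀ * J₄ * tiMatrixHom K F h2 ρ g = tiMult K F h2 ρ g • J₄ := by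
  by_cases hg : g ∈ (absGaloisRestrict K F).range
  · obtain ⟨σ, rfl⟩ := hg
    change (tiMatrixHom K F h2 ρ (absGaloisRestrict K F σ))ᵀ * J₄ *
        tiMatrixHom K F h2 ρ (absGaloisRestrict K F σ) =
      tiMult K F h2 ρ (absGaloisRestrict K F σ) • J₄
    rw [tiMatrixHom_absGaloisRestrict, kronecker_transpose_mul_J₄_mul, tiMult_absGaloisRestrict]
    rfl
  · obtain ⟨σ, hσ⟩ := mul_tiTau_inv_mem K F h2 hg
    have hgeq : g = absGaloisRestrict K F σ * tiTau K F h2 := by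
      rw [show absGaloisRestrict K F σ = g * (tiTau K F h2)⁻¹ from hσ, inv_mul_cancel_right]
    rw [hgeq, tiMatrixHom_absGaloisRestrict_mul_tiTau, tiMult_absGaloisRestrict_mul_tiTau,
      transpose_mul_J₄_mul_of_mul (kronecker_transpose_mul_J₄_mul _ _)
        (tensorTwist_transpose_mul_J₄_mul _ _)]
    rfl

/-- **The symmetric form `J` on `A^m`**, `m ≃ 2 × 2`: the relabelled `J₂ ⊗ J₂`. [folklore] -/
def tiForm (e : Fin 2 × Fin 2 ≃ Fin m) : Matrix (Fin m) (Fin m) A :=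
  Matrix.reindex e e J₄

omit [TopologicalSpace A] [IsTopologicalRing A] in
/-- `J` is symmetric. [folklore] -/
theorem tiForm_isSymm (e : Fin 2 × Fin 2 ≃ Fin m) : (tiForm e : Matrix (Fin m) (Fin m) A).IsSymm :=
  Matrix.IsSymm.submatrix (transpose_J₄ (A := A)) _

omit [TopologicalSpace A] [IsTopologicalRing A] in
/-- `det J = 1`, in particular a unit. [folklore] -/
theorem isUnit_det_tiForm (e : Fin 2 × Fin 2 ≃ Fin m) : IsUnit (tiForm e : Matrix (Fin m) (Fin m) A).det := by
  rw [tiForm, Matrix.det_reindex_self, det_J₄]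
  exact isUnit_one

/-- **`(⊗-Ind ρ)(g)ᵀ J (⊗-Ind ρ)(g) = μ(g) J` for all `g ∈ Γ_K`**: the tensor induction of a rank-two
representation along a quadratic extension is a representation into the orthogonal similitude group
`GO(J) ≅ GO₄` with multiplier `μ`. Ref: Calegari 2011, §2. [folklore] -/
theorem tensorInduce_transpose_mul_tiForm_mul (h2 : Module.finrank K F = 2) (e : Fin 2 × Fin 2 ≃ Fin m)
    (ρ : FramedGaloisRep F A 2) (g : absoluteGaloisGroup K) :
    ((tensorInduce K F h2 e ρ g : GL (Fin m) A) : Matrix (Fin m) (Fin m) A)ᵀ * tiForm e *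
        ((tensorInduce K F h2 e ρ g : GL (Fin m) A) : Matrix (Fin m) (Fin m) A) =
      tiMult K F h2 ρ g • tiForm e := by
  rw [tensorInduce_apply_coe, tiForm, Matrix.reindex_apply, Matrix.reindex_apply,
    Matrix.transpose_submatrix, Matrix.submatrix_mul_equiv, Matrix.submatrix_mul_equiv,
    tiMatrixHom_transpose_mul_J₄_mul, Matrix.submatrix_smul]
  rfl

end Form

/-! ### Over `ℚ`: imaginary quadratic `F`, complex conjugation, and the packaged statement -/

section Rat

open scoped NumberField
open IsDedekindDomain

variable (F : Type) [Field F] [NumberField F] [Algebra.IsQuadraticExtension ℚ F]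

omit [Algebra.IsQuadraticExtension ℚ F] in
/-- A complex conjugation of `Γ_ℚ` is an involution outside `res(Γ_F)` for `F` totally complex
(`Rat.not_mem_range_absGaloisRestrict_of_isComplexConjugation`, `IsComplexConjugation.sq_eq_one`).
[folklore] -/
theorem not_mem_range_and_mul_self_of_isComplexConjugation (hF : NumberField.IsTotallyComplex F)
    {φ : ℚ →+* ℝ} {c : absoluteGaloisGroup ℚ} (hc : IsComplexConjugation φ c) :
    c ∉ (absGaloisRestrict ℚ F).range ∧ c * c = 1 := by
  obtain rfl : φ = Rat.castHom ℝ := Subsingleton.elim _ _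
  exact ⟨Rat.not_mem_range_absGaloisRestrict_of_isComplexConjugation F hF hc,
    by rw [← sq]; exact hc.sq_eq_one⟩

/-- **Tensor induction from an imaginary quadratic field to `ℚ` — the unconditional conjuncts
(T0), (T1), (T2), (T5) of stub `stub_tensorInductionPD`.**  For `F/ℚ` imaginary quadratic and a
framed `ρ : Γ_F →ₜ* GL₂(ℚ̄_p)` unramified almost everywhere, `ψ = ⊗-Ind_{Γ_F}^{Γ_ℚ} ρ : Γ_ℚ →ₜ*
GL₄(ℚ̄_p)` (`tensorInduce`) satisfies: (T0) `tr ψ(res σ) = tr ρ(σ) tr ρ(σ')` whenever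
`res σ' = τ res(σ) τ⁻¹`, `τ ∉ res(Γ_F)`; (T1) `ψ` is unramified almost everywhere; (T2) `ψ` preserves a
symmetric form `J` with `det J` a unit up to a multiplier `μ` with `μ(c) = 1` at complex
conjugations; (T5) `tr ψ(c) = 2 ≠ 0` at complex conjugations.  (The `p`-adic Hodge theoretic conjunct
(T3) of the stub is NOT asserted here.)  Ref: F. Calegari, *Even Galois representations and the
Fontaine–Mazur conjecture*, §2; Curtis–Reiner, *Methods of representation theory* I, §13. [folklore] -/
theorem exists_tensorInduction (hF : NumberField.IsTotallyComplex F) (p : ℕ) [Fact p.Prime]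
    (ρ : FramedGaloisRep F (PadicAlgCl p) 2)
    (hunr : ∀ᶠ v : HeightOneSpectrum (𝓞 F) in Filter.cofinite, ρ.IsUnramifiedAt v) :
    ∃ ψ : FramedGaloisRep ℚ (PadicAlgCl p) 4,
      (∀ τ : absoluteGaloisGroup ℚ, τ ∉ Set.range (absGaloisRestrict ℚ F) →
        ∀ σ σ' : absoluteGaloisGroup F,
          absGaloisRestrict ℚ F σ' = τ * absGaloisRestrict ℚ F σ * τ⁻¹ →
            (ψ (absGaloisRestrict ℚ F σ)).val.trace = (ρ σ).val.trace * (ρ σ').val.trace) ∧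
      (∀ᶠ v : HeightOneSpectrum (𝓞 ℚ) in Filter.cofinite, ψ.IsUnramifiedAt v) ∧
      (∃ (J : Matrix (Fin 4) (Fin 4) (PadicAlgCl p)) (μ : absoluteGaloisGroup ℚ →* (PadicAlgCl p)ˣ),
        J.IsSymm ∧ IsUnit J.det ∧
          (∀ g : absoluteGaloisGroup ℚ,
            (ψ g).val.transpose * J * (ψ g).val = (μ g : PadicAlgCl p) • J) ∧
          ∀ (φ : ℚ →+* ℝ) (c : absoluteGaloisGroup ℚ), IsComplexConjugation φ c → μ c = 1) ∧
      (∀ (φ : ℚ →+* ℝ) (c : absoluteGaloisGroup ℚ), IsComplexConjugation φ c →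
        (ψ c).val.trace ≠ 0) := by
  have h2 : Module.finrank ℚ F = 2 := Algebra.IsQuadraticExtension.finrank_eq_two ℚ F
  let e : Fin 2 × Fin 2 ≃ Fin 4 := finProdFinEquiv
  refine ⟨tensorInduce ℚ F h2 e ρ, ?_, ?_, ?_, ?_⟩
  · intro τ hτ σ σ' hσ'
    exact trace_tensorInduce_absGaloisRestrict_eq ℚ F h2 e ρ (fun ⟨x, hx⟩ => hτ ⟨x, hx⟩) σ σ' hσ'
  · exact eventually_isUnramifiedAt_tensorInduce ℚ F h2 e ρ hunr
  · refine ⟨tiForm e, (tiMult ℚ F h2 ρ).toHomUnits, tiForm_isSymm e, isUnit_det_tiForm e,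
      fun g => tensorInduce_transpose_mul_tiForm_mul ℚ F h2 e ρ g, fun φ c hc => ?_⟩
    obtain ⟨hc1, hc2⟩ := not_mem_range_and_mul_self_of_isComplexConjugation F hF hc
    exact Units.ext (tiMult_of_not_mem_of_mul_self ℚ F h2 ρ hc1 hc2)
  · intro φ c hc
    obtain ⟨hc1, hc2⟩ := not_mem_range_and_mul_self_of_isComplexConjugation F hF hc
    change FramedRep.trace (tensorInduce ℚ F h2 e ρ) c ≠ 0
    rw [trace_tensorInduce_of_not_mem_of_mul_self ℚ F h2 e ρ hc1 hc2]
    exact Nat.cast_ne_zero.2 two_ne_zero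

end Rat

/-! ### The registered sub-goal: (T0), (T1), (T2), (T5) over `ℚ` -/

section Stub

open scoped NumberField
open IsDedekindDomain

/-- **Registered sub-goal `stub_tensorInductionPD_exists` of stub `stub_tensorInductionPD` (crux
`TensorSquareParallel`)**: the conjuncts (T0), (T1), (T2), (T5) of the stub for
`ψ = ⊗-Ind_{Γ_F}^{Γ_ℚ} ρ`, `F` imaginary quadratic (`exists_tensorInduction`); the `p`-adic Hodge
conjunct (T3) is not asserted.  Ref: F. Calegari, *Even Galois representations and the
Fontaine–Mazur conjecture*, §2. [folklore] -/
theorem stub_tensorInductionPD_exists : ∀ (F : Type) [Field F] [NumberField F] [Algebra.IsQuadraticExtension ℚ F], NumberField.IsTotallyComplex F → ∀ (p : ℕ) [Fact p.Prime] (ρ : FramedGaloisRep F (PadicAlgCl p) 2), (∀ᶠ v : HeightOneSpectrum (𝓞 F) in Filter.cofinite, ρ.IsUnramifiedAt v) → ∃ ψ : FramedGaloisRep ℚ (PadicAlgCl p) 4, (∀ τ : absoluteGaloisGroup ℚ, τ ∉ Set.range (absGaloisRestrict ℚ F) → ∀ σ σ' : absoluteGaloisGroup F, absGaloisRestrict ℚ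 F σ' = τ * absGaloisRestrict ℚ F σ * τ⁻¹ → (ψ (absGaloisRestrict ℚ F σ)).val.trace = (ρ σ).val.trace * (ρ σ').val.trace) ∧ (∀ᶠ v : HeightOneSpectrum (𝓞 ℚ) in Filter.cofinite, ψ.IsUnramifiedAt v) ∧ (∃ (J : Matrix (Fin 4) (Fin 4) (PadicAlgCl p)) (μ : absoluteGaloisGroup ℚ →* (PadicAlgCl p)ˣ), J.IsSymm ∧ IsUnit J.det ∧ (∀ g : absoluteGaloisGroup ℚ, (ψ g).val.transpose * J * (ψ g).val = (μ g : PadicAlgCl p) • J) ∧ ∀ (φ : ℚ →+* ℝ) (c : absoluteGaloisGroup ℚ), IsComplexConjugation φ c → μ c = 1) ∧ (∀ (φ : ℚ →+* ℝ) (c : absoluteGaloisGroup ℚ), IsComplexConjugation φ c → (ψ c).val.trace ≠ 0) :=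
  fun F _ _ _ hF p _ ρ hunr => exists_tensorInduction F hF p ρ hunr

end Stub

end Summit.Langlands.Langlands.Theorems.TensorSquareParallel

end
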